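import Summits.ABC.IUTFork.Conditional.AbcOfSGenuineKChosenDepthHexFamily
import HarnessLib

/-!
# Branch C / R-W «HEX-SHARP» (W-SPEC §6): the (d,a,b)-form depth inequality for the `λ_k` family over `7` with an EXPLICIT,
# FLOOR-FREE threshold — `k ≥ 37` at `l = 11`, `k ≥ 35` at `l = 13`, and a decidable integer test for every `(k, l)`

PROOF-ONLY file (D-0012; 0 definitions, 0 `Prop` facts) of the abc-iut cell (seat abc-iut-rp-m4 gen 3, booked «HEX-SHARP prover #1» by the
R-W lead abc-iut-plan g9 14:15:52Z; W-SPEC §6 `plan/rescue/W/W-SPEC.md`). TAKES NO SIDE on [IUTchIII] Cor. 3.12 or on any author. Pure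
composition BY NAME of abc-iut-c312-7's `GenuineK.exists_place_lamSeven` (`Cor312GenuineKDeepDatumLam`: at every genuine Θ-volume datum `T` over
`λ_k = 1/2 + 2/7^k`, `k ≥ 1`, `l` prime `≥ 11`, a bad TAME place `x₀ | 7` with `d + a + b ≤ 2 + log₇(46080·l(l−1)²(l+1))` and the CHOSEN realising
q-idele of norm `‖t_q(x₀)‖ = 7^{−k/l}` exactly) with a floor-free real-arithmetic lemma; nothing new about number fields is proved here.

WHY. abc-iut-c312-7's family theorem `GenuineK.exists_deep_place_lamSeven_all` (`AbcOfSGenuineKChosenDepthHexFamily`, p-id of record in the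
C scoreboard) gives the explicit depth inequality of abc-iut-w5-d107 (`Thm311.Real.not_licence_settingPrVolSharp_of_realises_explicit`, p437756:
`7^{((i+2)(d+a+b)+1)}·‖t_q(x₀)‖^{(i+1)²−1} < 1` at the top label `i + 1 = (l−1)/2`) for all `k ≥ k*` with `k*` NON-EXPLICIT (it comes from
abc-iut-C-cert-1's `Hex.core_ineq`, whose threshold is the `∃ k₁` of `exists_nat_forall_affine_log_le`, and through the DEGREE-form exponent
`4 + 2·log₇ N`). R-W's WINDOW-TABLE (W-SPEC §5) needs, per class `(λ_k, l)`, a NAMED theorem with an EXPLICIT `k`-range; W-SPEC §6 asks for the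
(d,a,b) form with a floor-free family lemma so that a finite table certifies the infinite tail. This file supplies it with the constants
ALREADY in the tree (c312-7's tame-route bound); the sharper constants of W-SPEC §6 (1)(2) (`d_w < 1`, the `e_w`-twist bound ⇒ `d+a+b < 8.3`,
`k₂(11) ≈ 24`) are a later refinement and are NOT used here.

RESULTS (ns `Summit.ABC.IUTFork.Conditional.Hex` / `…Conditional`):
* §1 `Hex.depth_ineq_of_lt` — FLOOR-FREE, parametric: for a label index `j ≥ 1`, reals `D`, `x` and `0 ≤ τ ≤ 7^{−x}`: if
  `(j+1)·D + 1 < x·(j²−1)` then `7^{(((j−1)+2)·D + 1)}·τ^{j²−1} < 1` (the tail of `Hex.core_ineq`, threshold as a hypothesis).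
* §2 `Hex.tame_ineq_of_pow_lt` — the DECIDABLE family test: with `D ≤ 2 + log N/log 7`, `N < 7^m` and the INTEGER threshold
  `l·((j+1)(2+m) + 1) < k·(j²−1)`, the inequality holds at `x = k/l`; MONOTONE in `k` (`Hex.threshold_mono`), so one row certifies every larger `k`.
* §3 `GenuineK.deep_place_lamSeven_of_threshold` — for EVERY `k ≥ 1`, prime `l ≥ 11`, `m` with `46080·l(l−1)²(l+1) < 7^m` and the integer
  threshold at `j = (l−1)/2`, and EVERY genuine Θ-volume datum `T` at `(λ_k, l)`: the top-label packet over `7` satisfies w5-d107's explicit depth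
  inequality at the chosen realising q-idele (same conclusion as `exists_deep_place_lamSeven_all`, explicit hypotheses instead of `∃ k*`).
* §4 `GenuineK.deep_place_lamSeven_eleven` (**`l = 11`, every `k ≥ 37`**: `N₁₁ = 608 256 000 < 7^{11}`, `11·79 = 869 < 24·k`) and
  `GenuineK.deep_place_lamSeven_thirteen` (**`l = 13`, every `k ≥ 35`**: `N₁₃ = 1 207 664 640 < 7^{11}`, `13·92 = 1196 < 35·k`).
* §5 `GenuineK.not_pilotKummerCompatHull_lamSeven_of_threshold` — PER DATUM, for every choice of the context binders: the hull-level clause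
  S_H = `Cor312Vol.PilotKummerCompatHull` at the window bed (abc-iut-c312-7's `Real.settingPrVolSharp (pilotDataOfK T.D T.K) …`, CHOSEN realising
  ideles, PINNED reading) FAILS under the hypotheses of §3 (abc-iut-C-cert-1's `GenuineK.not_pilotKummerCompatHull_chosen_of_explicit_depth`,
  p438886, one `obtain`); instances `…_eleven` (`k ≥ 37`) / `…_thirteen` (`k ≥ 35`).
CONSEQUENCE FOR THE TABLE (neutral): the classes `HEX:k:11`, `37 ≤ k`, and `HEX:k:13`, `35 ≤ k`, carry a deciding theorem of the (d,a,b) form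
(verdict REFUTED-dab at the top-label packet over `7`), against `k ≳ 70–78` for the degree form; the strip below (W-SPEC §5: model-conditional
threshold `k ≈ 8–10`) is untouched by this file. HONEST SCOPE (w5-d107's, binding): SHARP reading; the per-label licence is a
STRONGER-THAN-PRINT sufficient form of (xi-f); failure at one deep packet says NOTHING about the printed GLOBAL inequality, the number-level
`Cor22.Cor312AtDatum`, or any author's intended hull; refuted-as-typed ≠ refuted-in-print; typed ≠ proved; instantiated ≠ endorsed.
[cite: Mochizuki2012, IUTchIII Cor. 3.12 Step (xi-f) p. 184; IUTchIV Prop. 1.2 p. 10, Cor. 2.2 (ii) proof (P5) p. 46] [cite: ScholzeStix2018, §2.2 pp. 9–10]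
[claim: Mochizuki2012, status: disputed] for every IUT sentence quoted.
-/

noncomputable section

open Set Function NumberField IsDedekindDomain

namespace Summit.ABC.IUTFork.Conditional

namespace Hex

/-! ## §1. The floor-free arithmetic tail, threshold as a hypothesis -/

/-- **FLOOR-FREE DEPTH ARITHMETIC.** For a label index `j ≥ 1`, reals `D`, `x` and `0 ≤ τ ≤ 7^{−x}`: if `(j+1)·D + 1 < x·(j²−1)` then
`7^{(((j−1)+2)·D + 1)} · τ^{j²−1} < 1` (the exponent is written as abc-iut-c312-7 / C-cert-1 write it, `((j−1 : ℕ) : ℝ) + 2`). [folklore] -/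
theorem depth_ineq_of_lt (j : ℕ) (hj : 1 ≤ j) (x D τ : ℝ) (hτ0 : 0 ≤ τ) (hτ : τ ≤ (7 : ℝ) ^ (-x))
    (hD : ((j : ℝ) + 1) * D + 1 < x * (((j ^ 2 - 1 : ℕ) : ℝ))) :
    (7 : ℝ) ^ ((((j - 1 : ℕ) : ℝ) + 2) * D + 1) * τ ^ (j ^ 2 - 1) < 1 := by
  have h7 : (1 : ℝ) < 7 := by norm_num
  have h70 : (0 : ℝ) < 7 := by norm_num
  have hcast : ((j - 1 : ℕ) : ℝ) + 2 = (j : ℝ) + 1 := by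
    rw [Nat.cast_sub hj]; push_cast; ring
  rw [hcast]
  have hpow : τ ^ (j ^ 2 - 1) ≤ ((7 : ℝ) ^ (-x)) ^ (j ^ 2 - 1) := pow_le_pow_left₀ hτ0 hτ _
  have hA0 : (0 : ℝ) < (7 : ℝ) ^ (((j : ℝ) + 1) * D + 1) := Real.rpow_pos_of_pos h70 _
  calc (7 : ℝ) ^ (((j : ℝ) + 1) * D + 1) * τ ^ (j ^ 2 - 1)
      ≤ (7 : ℝ) ^ (((j : ℝ) + 1) * D + 1) * ((7 : ℝ) ^ (-x)) ^ (j ^ 2 - 1) := mul_le_mul_of_nonneg_left hpow hA0.le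
    _ = (7 : ℝ) ^ (((j : ℝ) + 1) * D + 1 - x * (((j ^ 2 - 1 : ℕ) : ℝ))) := by
        rw [← Real.rpow_natCast, ← Real.rpow_mul h70.le, ← Real.rpow_add h70]
        congr 1
        ring
    _ < (7 : ℝ) ^ (0 : ℝ) := Real.rpow_lt_rpow_of_exponent_lt h7 (by linarith)
    _ = 1 := Real.rpow_zero 7

/-! ## §2. The decidable family test (tame-route constant `2 + log₇ N`, `N < 7^m`, integer threshold) -/

/-- **THE FAMILY TEST.** If `D ≤ 2 + log N / log 7` with `1 ≤ N < 7^m`, and the INTEGER threshold `l·((j+1)(2+m) + 1) < k·(j²−1)` holds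
(`0 < l`, `1 ≤ j`), then for every `0 ≤ τ ≤ 7^{−k/l}`: `7^{(((j−1)+2)·D + 1)} · τ^{j²−1} < 1`. Both side conditions are decidable integer
facts; no floor, no `∃`. [folklore] -/
theorem tame_ineq_of_pow_lt (j k l m N : ℕ) (hj : 1 ≤ j) (hl : 0 < l) (hN1 : 1 ≤ N) (hNm : N < 7 ^ m) (D τ : ℝ)
    (hD : D ≤ 2 + Real.log (N : ℝ) / Real.log 7) (hk : l * ((j + 1) * (2 + m) + 1) < k * (j ^ 2 - 1))
    (hτ0 : 0 ≤ τ) (hτ : τ ≤ (7 : ℝ) ^ (-((k : ℝ) / l))) :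
    (7 : ℝ) ^ ((((j - 1 : ℕ) : ℝ) + 2) * D + 1) * τ ^ (j ^ 2 - 1) < 1 := by
  have hlog7 : 0 < Real.log 7 := Real.log_pos (by norm_num)
  have hNR : (0 : ℝ) < (N : ℝ) := by exact_mod_cast hN1
  have hNm' : (N : ℝ) < (7 : ℝ) ^ m := by exact_mod_cast hNm
  have hlogN : Real.log (N : ℝ) < (m : ℝ) * Real.log 7 := by
    rw [← Real.log_pow]; exact Real.log_lt_log hNR hNm'
  have hD' : D < 2 + (m : ℝ) := by
    have : Real.log (N : ℝ) / Real.log 7 < (m : ℝ) := (div_lt_iff₀ hlog7).2 hlogN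
    linarith
  have hlR : (0 : ℝ) < (l : ℝ) := by exact_mod_cast hl
  have hkR : (l : ℝ) * (((j : ℝ) + 1) * (2 + (m : ℝ)) + 1) < (k : ℝ) * (((j ^ 2 - 1 : ℕ) : ℝ)) := by exact_mod_cast hk
  have hj1 : (0 : ℝ) < (j : ℝ) + 1 := by positivity
  have h1 : ((j : ℝ) + 1) * D + 1 < ((j : ℝ) + 1) * (2 + (m : ℝ)) + 1 := by
    nlinarith [mul_lt_mul_of_pos_left hD' hj1]
  have h2 : ((j : ℝ) + 1) * (2 + (m : ℝ)) + 1 < (k : ℝ) / l * (((j ^ 2 - 1 : ℕ) : ℝ)) := by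
    rw [div_mul_eq_mul_div, lt_div_iff₀ hlR]
    linarith
  exact depth_ineq_of_lt j hj ((k : ℝ) / l) D τ hτ0 hτ (by linarith)

/-- The integer threshold is MONOTONE in `k`: once met at `k`, it is met at every `k' ≥ k` — one table row certifies the whole tail. [folklore] -/
theorem threshold_mono {j k k' l m : ℕ} (hk : l * ((j + 1) * (2 + m) + 1) < k * (j ^ 2 - 1)) (hkk' : k ≤ k') :
    l * ((j + 1) * (2 + m) + 1) < k' * (j ^ 2 - 1) :=
  lt_of_lt_of_le hk (Nat.mul_le_mul_right _ hkk')

end Hex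

open Thm311 Thm311.Real Cor312 Cor312Vol Cor312Prov Literature.IUT.LogThetaLattice Literature.IUT.LogVolume
  Literature.IUT.HodgeTheaters Literature.NumberTheory.DiophantineGeometry.GenEll Summit.ABC.ABC.Theorems

/-! ## §3. The family with an explicit threshold -/

/-- **Explicit-threshold twin of `GenuineK.exists_deep_place_lamSeven_all`.** For every `k ≥ 1`, prime `l ≥ 11`, `m` with
`46080·l(l−1)²(l+1) < 7^m` and the integer threshold `l·(((l−1)/2 + 1)(2+m) + 1) < k·(((l−1)/2)² − 1)`, and EVERY genuine Θ-volume datum `T` at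
`(ratPoint λ_k, l)`: the top label `i = (l−1)/2 − 1` and some fibre point `x₀ | 7` in the bad set satisfy abc-iut-w5-d107's explicit depth
inequality `7^{((i+2)(d+a+b)+1)}·‖t_q(x₀)‖^{(i+1)²−1} < 1` at the chosen realising q-idele (abc-iut-c312-7's `GenuineK.exists_place_lamSeven` +
`Hex.tame_ineq_of_pow_lt`). [cite: Mochizuki2012, IUTchIV Prop. 1.2 p. 10, Cor. 2.2 (ii) proof (P5) p. 46] [claim: Mochizuki2012, status: disputed] -/
theorem GenuineK.deep_place_lamSeven_of_threshold {k l m : ℕ} (hk1 : 1 ≤ k) (hl : l.Prime) (h11 : 11 ≤ l)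
    (hNm : 46080 * (l * (l - 1) ^ 2 * (l + 1)) < 7 ^ m)
    (hk : l * (((l - 1) / 2 + 1) * (2 + m) + 1) < k * (((l - 1) / 2) ^ 2 - 1))
    (T : Cor22.ThetaVolumeDatumAt (ratPoint ((2 : ℚ)⁻¹ + 2 / 7 ^ k)) l) :
    letI := T.instFieldF; letI := T.instNumberFieldF; letI := T.instAlgebraF; letI := T.instFieldK
    letI := T.instNumberFieldK; letI := T.instAlgebraK; letI := T.instFieldFbar; letI := T.instAlgebraFbar
    letI := T.instAlgebraKFbar; letI := T.instIsElliptic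
    haveI : Fact (Nat.Prime 7) := ⟨by norm_num⟩
    ∃ (i : Fin (thetaIndex (pilotDataOfK T.D T.K)).lstar) (x₀ : (thetaIndex (pilotDataOfK T.D T.K)).Fibre (.inr ⟨7, by norm_num⟩)),
      (i : ℕ) = (l - 1) / 2 - 1 ∧
      placeOf (pilotDataOfK T.D T.K) 7 x₀ ∈ (pilotDataOfK T.D T.K).S ∧
      (7 : ℝ) ^ ((((i : ℕ) : ℝ) + 2) * (differentOrd 7 (kOf (pilotDataOfK T.D T.K) 7 x₀)
          + logRadiusA 7 (absRamificationIdx 7 (kOf (pilotDataOfK T.D T.K) 7 x₀))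
          + logRadiusB 7 (absRamificationIdx 7 (kOf (pilotDataOfK T.D T.K) 7 x₀))) + 1) *
        ‖(exists_realising_qIdeles_pilotDataOfK T.D).choose ⟨7, by norm_num⟩ x₀‖ ^ (((i : ℕ) + 1) ^ 2 - 1) < 1 := by
  classical
  letI := T.instFieldF; letI := T.instNumberFieldF; letI := T.instAlgebraF; letI := T.instFieldK
  letI := T.instNumberFieldK; letI := T.instAlgebraK; letI := T.instFieldFbar; letI := T.instAlgebraFbar
  letI := T.instAlgebraKFbar; letI := T.instIsElliptic
  haveI : Fact (Nat.Prime 7) := ⟨by norm_num⟩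
  obtain ⟨x₀, hS, -, -, hB, hnorm⟩ := GenuineK.exists_place_lamSeven hk1 hl h11 T
  have hlstar : (thetaIndex (pilotDataOfK T.D T.K)).lstar = (l - 1) / 2 := rfl
  have hil : (l - 1) / 2 - 1 < (thetaIndex (pilotDataOfK T.D T.K)).lstar := by rw [hlstar]; omega
  refine ⟨⟨(l - 1) / 2 - 1, hil⟩, x₀, rfl, hS, ?_⟩
  have hN1 : 1 ≤ 46080 * (l * (l - 1) ^ 2 * (l + 1)) := by
    have : 1 ≤ l * (l - 1) ^ 2 * (l + 1) := Nat.one_le_iff_ne_zero.mpr (Nat.mul_ne_zero (Nat.mul_ne_zero (by omega) (pow_ne_zero _ (by omega))) (by omega))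
    omega
  have hj1 : 1 ≤ (l - 1) / 2 := by omega
  have hl0 : 0 < l := by omega
  have hτ0 : (0 : ℝ) ≤ (7 : ℝ) ^ (-((k : ℝ) / l)) := by positivity
  have hidx : ((l - 1) / 2 - 1) + 1 = (l - 1) / 2 := by omega
  show (7 : ℝ) ^ _ * ‖(exists_realising_qIdeles_pilotDataOfK T.D).choose ⟨7, by norm_num⟩ x₀‖ ^ ((((l - 1) / 2 - 1) + 1) ^ 2 - 1) < 1
  rw [hnorm, hidx]
  exact Hex.tame_ineq_of_pow_lt ((l - 1) / 2) k l m _ hj1 hl0 hN1 hNm _ _ hB hk hτ0 le_rfl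

/-! ## §4. The two table instances: `l = 11` from `k = 37`, `l = 13` from `k = 35` -/

/-- **`l = 11`: every `k ≥ 37`** (`46080·11·10²·12 = 608 256 000 < 7^{11} = 1 977 326 743`; threshold `11·(6·13 + 1) = 869 < 24·k ⟺ k ≥ 37`).
For every genuine Θ-volume datum at `(ratPoint λ_k, 11)` the top-label packet (`j = 5`) over `7` is explicitly deep. [claim: Mochizuki2012, status: disputed] -/
theorem GenuineK.deep_place_lamSeven_eleven {k : ℕ} (hk : 37 ≤ k)
    (T : Cor22.ThetaVolumeDatumAt (ratPoint ((2 : ℚ)⁻¹ + 2 / 7 ^ k)) 11) :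
    letI := T.instFieldF; letI := T.instNumberFieldF; letI := T.instAlgebraF; letI := T.instFieldK
    letI := T.instNumberFieldK; letI := T.instAlgebraK; letI := T.instFieldFbar; letI := T.instAlgebraFbar
    letI := T.instAlgebraKFbar; letI := T.instIsElliptic
    haveI : Fact (Nat.Prime 7) := ⟨by norm_num⟩
    ∃ (i : Fin (thetaIndex (pilotDataOfK T.D T.K)).lstar) (x₀ : (thetaIndex (pilotDataOfK T.D T.K)).Fibre (.inr ⟨7, by norm_num⟩)),
      (i : ℕ) = 4 ∧
      placeOf (pilotDataOfK T.D T.K) 7 x₀ ∈ (pilotDataOfK T.D T.K).S ∧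
      (7 : ℝ) ^ ((((i : ℕ) : ℝ) + 2) * (differentOrd 7 (kOf (pilotDataOfK T.D T.K) 7 x₀)
          + logRadiusA 7 (absRamificationIdx 7 (kOf (pilotDataOfK T.D T.K) 7 x₀))
          + logRadiusB 7 (absRamificationIdx 7 (kOf (pilotDataOfK T.D T.K) 7 x₀))) + 1) *
        ‖(exists_realising_qIdeles_pilotDataOfK T.D).choose ⟨7, by norm_num⟩ x₀‖ ^ (((i : ℕ) + 1) ^ 2 - 1) < 1 :=
  GenuineK.deep_place_lamSeven_of_threshold (m := 11) (by omega) (by norm_num) le_rfl (by norm_num) (by norm_num; omega) T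

/-- **`l = 13`: every `k ≥ 35`** (`46080·13·12²·14 = 1 207 664 640 < 7^{11}`; threshold `13·(7·13 + 1) = 1196 < 35·k ⟺ k ≥ 35`). For every
genuine Θ-volume datum at `(ratPoint λ_k, 13)` the top-label packet (`j = 6`) over `7` is explicitly deep. [claim: Mochizuki2012, status: disputed] -/
theorem GenuineK.deep_place_lamSeven_thirteen {k : ℕ} (hk : 35 ≤ k)
    (T : Cor22.ThetaVolumeDatumAt (ratPoint ((2 : ℚ)⁻¹ + 2 / 7 ^ k)) 13) :
    letI := T.instFieldF; letI := T.instNumberFieldF; letI := T.instAlgebraF; letI := T.instFieldK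
    letI := T.instNumberFieldK; letI := T.instAlgebraK; letI := T.instFieldFbar; letI := T.instAlgebraFbar
    letI := T.instAlgebraKFbar; letI := T.instIsElliptic
    haveI : Fact (Nat.Prime 7) := ⟨by norm_num⟩
    ∃ (i : Fin (thetaIndex (pilotDataOfK T.D T.K)).lstar) (x₀ : (thetaIndex (pilotDataOfK T.D T.K)).Fibre (.inr ⟨7, by norm_num⟩)),
      (i : ℕ) = 5 ∧
      placeOf (pilotDataOfK T.D T.K) 7 x₀ ∈ (pilotDataOfK T.D T.K).S ∧
      (7 : ℝ) ^ ((((i : ℕ) : ℝ) + 2) * (differentOrd 7 (kOf (pilotDataOfK T.D T.K) 7 x₀)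
          + logRadiusA 7 (absRamificationIdx 7 (kOf (pilotDataOfK T.D T.K) 7 x₀))
          + logRadiusB 7 (absRamificationIdx 7 (kOf (pilotDataOfK T.D T.K) 7 x₀))) + 1) *
        ‖(exists_realising_qIdeles_pilotDataOfK T.D).choose ⟨7, by norm_num⟩ x₀‖ ^ (((i : ℕ) + 1) ^ 2 - 1) < 1 :=
  GenuineK.deep_place_lamSeven_of_threshold (m := 11) (by omega) (by norm_num) (by norm_num) (by norm_num) (by norm_num; omega) T

/-! ## §5. Per datum: the hull-level clause S_H fails at the window bed for these classes -/

/-- **PER-DATUM REFUTATION OF S_H ON THE EXPLICIT RANGE.** Under the hypotheses of `GenuineK.deep_place_lamSeven_of_threshold` (`k ≥ 1`, `l`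
prime `≥ 11`, `46080·l(l−1)²(l+1) < 7^m`, the integer threshold), at EVERY genuine Θ-volume datum `T` at `(ratPoint λ_k, l)` and for EVERY choice
of the context binders (columns, frames, lattice, signature, q-datum …), the hull-level clause `Cor312Vol.PilotKummerCompatHull` at
abc-iut-c312-7's sharp genuine setting over `T.K` with the CHOSEN realising ideles and the PINNED reading — the per-datum instance of the S_H
binder of the branch-C certificates (`abc_of_SH_v6K` / the window line `abc_of_SH_v8K_window`…) — FAILS (abc-iut-C-cert-1's
`GenuineK.not_pilotKummerCompatHull_chosen_of_explicit_depth`, p438886, fed by §3). Refuted-as-typed at one deep packet; nothing about the printed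
global inequality. [cite: Mochizuki2012, IUTchIII Cor. 3.12 Step (xi-f) p. 184] [claim: Mochizuki2012, status: disputed] -/
theorem GenuineK.not_pilotKummerCompatHull_lamSeven_of_threshold {k l m : ℕ} (hk1 : 1 ≤ k) (hl : l.Prime) (h11 : 11 ≤ l)
    (hNm : 46080 * (l * (l - 1) ^ 2 * (l + 1)) < 7 ^ m)
    (hk : l * (((l - 1) / 2 + 1) * (2 + m) + 1) < k * (((l - 1) / 2) ^ 2 - 1))
    (T : Cor22.ThetaVolumeDatumAt (ratPoint ((2 : ℚ)⁻¹ + 2 / 7 ^ k)) l) :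
    letI := T.instFieldF; letI := T.instNumberFieldF; letI := T.instAlgebraF; letI := T.instFieldK
    letI := T.instNumberFieldK; letI := T.instAlgebraK; letI := T.instFieldFbar; letI := T.instAlgebraFbar
    letI := T.instAlgebraKFbar; letI := T.instIsElliptic
    ∀ (M : Type) [Field M] [NumberField M]
      (archPk : ∀ (j : (thetaIndex (pilotDataOfK T.D T.K)).Label) (vQ : (thetaIndex (pilotDataOfK T.D T.K)).VQ),
        Set ((logShellsDH (pilotDataOfK T.D T.K) (analyticLogv T.K)).Packet j vQ))
      (archSub : ∀ (j : (thetaIndex (pilotDataOfK T.D T.K)).Label) (v : (thetaIndex (pilotDataOfK T.D T.K)).V),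
        Set ((logShellsDH (pilotDataOfK T.D T.K) (analyticLogv T.K)).Packet j ((thetaIndex (pilotDataOfK T.D T.K)).over v)))
      (Ψ : ℤ → ∀ v : (thetaIndex (pilotDataOfK T.D T.K)).V, v ∈ (thetaIndex (pilotDataOfK T.D T.K)).Vbad →
        Set ((logShellsDH (pilotDataOfK T.D T.K) (analyticLogv T.K)).StarPacket v))
      (act : ℤ → ∀ v : (thetaIndex (pilotDataOfK T.D T.K)).V, v ∈ (thetaIndex (pilotDataOfK T.D T.K)).Vbad →
        (logShellsDH (pilotDataOfK T.D T.K) (analyticLogv T.K)).StarPacket v →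
          Module.End ℚ ((logShellsDH (pilotDataOfK T.D T.K) (analyticLogv T.K)).StarPacket v))
      (Mmod : ℤ → ∀ j : (thetaIndex (pilotDataOfK T.D T.K)).LabelStar, Set ((logShellsDH (pilotDataOfK T.D T.K) (analyticLogv T.K)).GlobalPacket j.1))
      (region : ℤ → ∀ j : (thetaIndex (pilotDataOfK T.D T.K)).LabelStar, FinDivisor M → ∀ vQ : (thetaIndex (pilotDataOfK T.D T.K)).VQ,
        Set ((logShellsDH (pilotDataOfK T.D T.K) (analyticLogv T.K)).Packet j.1 vQ))
      (frobAdm : ℤ → ℤ → ∀ (j : (thetaIndex (pilotDataOfK T.D T.K)).Label) (vQ : (thetaIndex (pilotDataOfK T.D T.K)).VQ),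
        Set ((logShellsDH (pilotDataOfK T.D T.K) (analyticLogv T.K)).Packet j vQ) → Prop)
      (frobLogvol : ℤ → ℤ → ∀ (j : (thetaIndex (pilotDataOfK T.D T.K)).Label) (vQ : (thetaIndex (pilotDataOfK T.D T.K)).VQ),
        Set ((logShellsDH (pilotDataOfK T.D T.K) (analyticLogv T.K)).Packet j vQ) → ℝ)
      (frobΨ : ℤ → ℤ → ∀ v : (thetaIndex (pilotDataOfK T.D T.K)).V, v ∈ (thetaIndex (pilotDataOfK T.D T.K)).Vbad →
        Set ((logShellsDH (pilotDataOfK T.D T.K) (analyticLogv T.K)).StarPacket v))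
      (frobMmod : ℤ → ℤ → ∀ j : (thetaIndex (pilotDataOfK T.D T.K)).LabelStar, Set ((logShellsDH (pilotDataOfK T.D T.K) (analyticLogv T.K)).GlobalPacket j.1))
      (unitImage : ℤ → ℤ → ℕ → ∀ (j : (thetaIndex (pilotDataOfK T.D T.K)).Label) (vQ : (thetaIndex (pilotDataOfK T.D T.K)).VQ),
        Set ((logShellsDH (pilotDataOfK T.D T.K) (analyticLogv T.K)).Packet j vQ))
      (ballImage : ℤ → ℤ → ∀ (j : (thetaIndex (pilotDataOfK T.D T.K)).Label) (vQ : (thetaIndex (pilotDataOfK T.D T.K)).VQ),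
        Set ((logShellsDH (pilotDataOfK T.D T.K) (analyticLogv T.K)).Packet j vQ))
      (thetaDiv : ℤ → ℤ → LgpDivisor M (thetaIndex (pilotDataOfK T.D T.K)).lstar)
      (n : ℤ) {HT : Type} {LogLink : HT → HT → Type} {IsFull : ∀ {s t : HT}, LogLink s t → Prop}
      (lat : LGPGaussianLogThetaLattice LogLink IsFull)
      {Frd : Type} {IsoF : Frd → Frd → Type} {Ob : Frd → Type} {realify : Frd → Frd} {Strip : Type}
      {IsoS : Strip → Strip → Type} {Mv : ∀ v : (thetaIndex (pilotDataOfK T.D T.K)).V, v ∈ (thetaIndex (pilotDataOfK T.D T.K)).Vbad → Type}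
      [∀ v h, Monoid (Mv v h)]
      (sig : GlobalLGPFrobenioidSignature (thetaIndex (pilotDataOfK T.D T.K)).lstar (thetaIndex (pilotDataOfK T.D T.K)).V
        (· ∈ (thetaIndex (pilotDataOfK T.D T.K)).Vbad) Frd IsoF Ob realify Strip IsoS Mv)
      (split : SplittingMonoids Mv) {ObΔ : Type} {N : ∀ v : (thetaIndex (pilotDataOfK T.D T.K)).V, v ∈ (thetaIndex (pilotDataOfK T.D T.K)).Vbad → Type}
      [∀ v h, Monoid (N v h)] (qData : QPilotData ObΔ N)
      (qK : ∀ v : (thetaIndex (pilotDataOfK T.D T.K)).V, v ∈ (thetaIndex (pilotDataOfK T.D T.K)).Vbad →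
        Set ((logShellsDH (pilotDataOfK T.D T.K) (analyticLogv T.K)).StarPacket v)),
      ¬ Cor312Vol.PilotKummerCompatHull
          (LatticeSituation.ofShells (logShellsDH (pilotDataOfK T.D T.K) (analyticLogv T.K)) M archPk archSub
            (summandPiecesPr (pilotDataOfK T.D T.K) (logvAnalytic_analyticLogv (F := T.K))).Adm
            (summandPiecesPr (pilotDataOfK T.D T.K) (logvAnalytic_analyticLogv (F := T.K))).logvol Ψ act Mmod region frobAdm frobLogvol frobΨ
            frobMmod unitImage ballImage thetaDiv)
          (settingPrVolSharp (pilotDataOfK T.D T.K) (logvAnalytic_analyticLogv (F := T.K)) M archPk archSub Ψ act Mmod region n lat sig split qData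
            (exists_realising_qIdeles_pilotDataOfK T.D).choose (exists_realising_thetaIdeles_pilotDataOfK T.D).choose
            (exists_realising_qIdeles_pilotDataOfK T.D).choose_spec.1 (exists_realising_qIdeles_pilotDataOfK T.D).choose_spec.2.1)
          (fun _ => Cor312.Setting.qRegion
            (settingPrVolSharp (pilotDataOfK T.D T.K) (logvAnalytic_analyticLogv (F := T.K)) M archPk archSub Ψ act Mmod region n lat sig split qData
              (exists_realising_qIdeles_pilotDataOfK T.D).choose (exists_realising_thetaIdeles_pilotDataOfK T.D).choose
              (exists_realising_qIdeles_pilotDataOfK T.D).choose_spec.1 (exists_realising_qIdeles_pilotDataOfK T.D).choose_spec.2.1)) qK := by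
  classical
  letI := T.instFieldF; letI := T.instNumberFieldF; letI := T.instAlgebraF; letI := T.instFieldK
  letI := T.instNumberFieldK; letI := T.instAlgebraK; letI := T.instFieldFbar; letI := T.instAlgebraFbar
  letI := T.instAlgebraKFbar; letI := T.instIsElliptic
  intro M _ _ archPk archSub Ψ act Mmod region frobAdm frobLogvol frobΨ frobMmod unitImage ballImage thetaDiv n HT LogLink IsFull lat
    Frd IsoF Ob realify Strip IsoS Mv _ sig split ObΔ N _ qData qK
  obtain ⟨i, x₀, -, -, hdeep⟩ := GenuineK.deep_place_lamSeven_of_threshold hk1 hl h11 hNm hk T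
  exact GenuineK.not_pilotKummerCompatHull_chosen_of_explicit_depth T.D M archPk archSub Ψ act Mmod region frobAdm frobLogvol frobΨ
    frobMmod unitImage ballImage thetaDiv n lat sig split qData qK ⟨7, by norm_num⟩ i x₀ hdeep

/-- **`l = 11`, every `k ≥ 37`: S_H fails at the window bed** of every genuine Θ-volume datum at `(ratPoint λ_k, 11)` (chosen realising ideles,
pinned reading; every choice of the context binders). [claim: Mochizuki2012, status: disputed] -/
theorem GenuineK.not_pilotKummerCompatHull_lamSeven_eleven {k : ℕ} (hk : 37 ≤ k)
    (T : Cor22.ThetaVolumeDatumAt (ratPoint ((2 : ℚ)⁻¹ + 2 / 7 ^ k)) 11) :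
    letI := T.instFieldF; letI := T.instNumberFieldF; letI := T.instAlgebraF; letI := T.instFieldK
    letI := T.instNumberFieldK; letI := T.instAlgebraK; letI := T.instFieldFbar; letI := T.instAlgebraFbar
    letI := T.instAlgebraKFbar; letI := T.instIsElliptic
    ∀ (M : Type) [Field M] [NumberField M]
      (archPk : ∀ (j : (thetaIndex (pilotDataOfK T.D T.K)).Label) (vQ : (thetaIndex (pilotDataOfK T.D T.K)).VQ),
        Set ((logShellsDH (pilotDataOfK T.D T.K) (analyticLogv T.K)).Packet j vQ))
      (archSub : ∀ (j : (thetaIndex (pilotDataOfK T.D T.K)).Label) (v : (thetaIndex (pilotDataOfK T.D T.K)).V),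
        Set ((logShellsDH (pilotDataOfK T.D T.K) (analyticLogv T.K)).Packet j ((thetaIndex (pilotDataOfK T.D T.K)).over v)))
      (Ψ : ℤ → ∀ v : (thetaIndex (pilotDataOfK T.D T.K)).V, v ∈ (thetaIndex (pilotDataOfK T.D T.K)).Vbad →
        Set ((logShellsDH (pilotDataOfK T.D T.K) (analyticLogv T.K)).StarPacket v))
      (act : ℤ → ∀ v : (thetaIndex (pilotDataOfK T.D T.K)).V, v ∈ (thetaIndex (pilotDataOfK T.D T.K)).Vbad →
        (logShellsDH (pilotDataOfK T.D T.K) (analyticLogv T.K)).StarPacket v →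
          Module.End ℚ ((logShellsDH (pilotDataOfK T.D T.K) (analyticLogv T.K)).StarPacket v))
      (Mmod : ℤ → ∀ j : (thetaIndex (pilotDataOfK T.D T.K)).LabelStar, Set ((logShellsDH (pilotDataOfK T.D T.K) (analyticLogv T.K)).GlobalPacket j.1))
      (region : ℤ → ∀ j : (thetaIndex (pilotDataOfK T.D T.K)).LabelStar, FinDivisor M → ∀ vQ : (thetaIndex (pilotDataOfK T.D T.K)).VQ,
        Set ((logShellsDH (pilotDataOfK T.D T.K) (analyticLogv T.K)).Packet j.1 vQ))
      (frobAdm : ℤ → ℤ → ∀ (j : (thetaIndex (pilotDataOfK T.D T.K)).Label) (vQ : (thetaIndex (pilotDataOfK T.D T.K)).VQ),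
        Set ((logShellsDH (pilotDataOfK T.D T.K) (analyticLogv T.K)).Packet j vQ) → Prop)
      (frobLogvol : ℤ → ℤ → ∀ (j : (thetaIndex (pilotDataOfK T.D T.K)).Label) (vQ : (thetaIndex (pilotDataOfK T.D T.K)).VQ),
        Set ((logShellsDH (pilotDataOfK T.D T.K) (analyticLogv T.K)).Packet j vQ) → ℝ)
      (frobΨ : ℤ → ℤ → ∀ v : (thetaIndex (pilotDataOfK T.D T.K)).V, v ∈ (thetaIndex (pilotDataOfK T.D T.K)).Vbad →
        Set ((logShellsDH (pilotDataOfK T.D T.K) (analyticLogv T.K)).StarPacket v))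
      (frobMmod : ℤ → ℤ → ∀ j : (thetaIndex (pilotDataOfK T.D T.K)).LabelStar, Set ((logShellsDH (pilotDataOfK T.D T.K) (analyticLogv T.K)).GlobalPacket j.1))
      (unitImage : ℤ → ℤ → ℕ → ∀ (j : (thetaIndex (pilotDataOfK T.D T.K)).Label) (vQ : (thetaIndex (pilotDataOfK T.D T.K)).VQ),
        Set ((logShellsDH (pilotDataOfK T.D T.K) (analyticLogv T.K)).Packet j vQ))
      (ballImage : ℤ → ℤ → ∀ (j : (thetaIndex (pilotDataOfK T.D T.K)).Label) (vQ : (thetaIndex (pilotDataOfK T.D T.K)).VQ),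
        Set ((logShellsDH (pilotDataOfK T.D T.K) (analyticLogv T.K)).Packet j vQ))
      (thetaDiv : ℤ → ℤ → LgpDivisor M (thetaIndex (pilotDataOfK T.D T.K)).lstar)
      (n : ℤ) {HT : Type} {LogLink : HT → HT → Type} {IsFull : ∀ {s t : HT}, LogLink s t → Prop}
      (lat : LGPGaussianLogThetaLattice LogLink IsFull)
      {Frd : Type} {IsoF : Frd → Frd → Type} {Ob : Frd → Type} {realify : Frd → Frd} {Strip : Type}
      {IsoS : Strip → Strip → Type} {Mv : ∀ v : (thetaIndex (pilotDataOfK T.D T.K)).V, v ∈ (thetaIndex (pilotDataOfK T.D T.K)).Vbad → Type}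
      [∀ v h, Monoid (Mv v h)]
      (sig : GlobalLGPFrobenioidSignature (thetaIndex (pilotDataOfK T.D T.K)).lstar (thetaIndex (pilotDataOfK T.D T.K)).V
        (· ∈ (thetaIndex (pilotDataOfK T.D T.K)).Vbad) Frd IsoF Ob realify Strip IsoS Mv)
      (split : SplittingMonoids Mv) {ObΔ : Type} {N : ∀ v : (thetaIndex (pilotDataOfK T.D T.K)).V, v ∈ (thetaIndex (pilotDataOfK T.D T.K)).Vbad → Type}
      [∀ v h, Monoid (N v h)] (qData : QPilotData ObΔ N)
      (qK : ∀ v : (thetaIndex (pilotDataOfK T.D T.K)).V, v ∈ (thetaIndex (pilotDataOfK T.D T.K)).Vbad →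
        Set ((logShellsDH (pilotDataOfK T.D T.K) (analyticLogv T.K)).StarPacket v)),
      ¬ Cor312Vol.PilotKummerCompatHull
          (LatticeSituation.ofShells (logShellsDH (pilotDataOfK T.D T.K) (analyticLogv T.K)) M archPk archSub
            (summandPiecesPr (pilotDataOfK T.D T.K) (logvAnalytic_analyticLogv (F := T.K))).Adm
            (summandPiecesPr (pilotDataOfK T.D T.K) (logvAnalytic_analyticLogv (F := T.K))).logvol Ψ act Mmod region frobAdm frobLogvol frobΨ
            frobMmod unitImage ballImage thetaDiv)
          (settingPrVolSharp (pilotDataOfK T.D T.K) (logvAnalytic_analyticLogv (F := T.K)) M archPk archSub Ψ act Mmod region n lat sig split qData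
            (exists_realising_qIdeles_pilotDataOfK T.D).choose (exists_realising_thetaIdeles_pilotDataOfK T.D).choose
            (exists_realising_qIdeles_pilotDataOfK T.D).choose_spec.1 (exists_realising_qIdeles_pilotDataOfK T.D).choose_spec.2.1)
          (fun _ => Cor312.Setting.qRegion
            (settingPrVolSharp (pilotDataOfK T.D T.K) (logvAnalytic_analyticLogv (F := T.K)) M archPk archSub Ψ act Mmod region n lat sig split qData
              (exists_realising_qIdeles_pilotDataOfK T.D).choose (exists_realising_thetaIdeles_pilotDataOfK T.D).choose
              (exists_realising_qIdeles_pilotDataOfK T.D).choose_spec.1 (exists_realising_qIdeles_pilotDataOfK T.D).choose_spec.2.1)) qK :=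
  GenuineK.not_pilotKummerCompatHull_lamSeven_of_threshold (m := 11) (by omega) (by norm_num) le_rfl (by norm_num) (by norm_num; omega) T

/-- **`l = 13`, every `k ≥ 35`: S_H fails at the window bed** of every genuine Θ-volume datum at `(ratPoint λ_k, 13)`. [claim: Mochizuki2012, status: disputed] -/
theorem GenuineK.not_pilotKummerCompatHull_lamSeven_thirteen {k : ℕ} (hk : 35 ≤ k)
    (T : Cor22.ThetaVolumeDatumAt (ratPoint ((2 : ℚ)⁻¹ + 2 / 7 ^ k)) 13) :
    letI := T.instFieldF; letI := T.instNumberFieldF; letI := T.instAlgebraF; letI := T.instFieldK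
    letI := T.instNumberFieldK; letI := T.instAlgebraK; letI := T.instFieldFbar; letI := T.instAlgebraFbar
    letI := T.instAlgebraKFbar; letI := T.instIsElliptic
    ∀ (M : Type) [Field M] [NumberField M]
      (archPk : ∀ (j : (thetaIndex (pilotDataOfK T.D T.K)).Label) (vQ : (thetaIndex (pilotDataOfK T.D T.K)).VQ),
        Set ((logShellsDH (pilotDataOfK T.D T.K) (analyticLogv T.K)).Packet j vQ))
      (archSub : ∀ (j : (thetaIndex (pilotDataOfK T.D T.K)).Label) (v : (thetaIndex (pilotDataOfK T.D T.K)).V),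
        Set ((logShellsDH (pilotDataOfK T.D T.K) (analyticLogv T.K)).Packet j ((thetaIndex (pilotDataOfK T.D T.K)).over v)))
      (Ψ : ℤ → ∀ v : (thetaIndex (pilotDataOfK T.D T.K)).V, v ∈ (thetaIndex (pilotDataOfK T.D T.K)).Vbad →
        Set ((logShellsDH (pilotDataOfK T.D T.K) (analyticLogv T.K)).StarPacket v))
      (act : ℤ → ∀ v : (thetaIndex (pilotDataOfK T.D T.K)).V, v ∈ (thetaIndex (pilotDataOfK T.D T.K)).Vbad →
        (logShellsDH (pilotDataOfK T.D T.K) (analyticLogv T.K)).StarPacket v →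
          Module.End ℚ ((logShellsDH (pilotDataOfK T.D T.K) (analyticLogv T.K)).StarPacket v))
      (Mmod : ℤ → ∀ j : (thetaIndex (pilotDataOfK T.D T.K)).LabelStar, Set ((logShellsDH (pilotDataOfK T.D T.K) (analyticLogv T.K)).GlobalPacket j.1))
      (region : ℤ → ∀ j : (thetaIndex (pilotDataOfK T.D T.K)).LabelStar, FinDivisor M → ∀ vQ : (thetaIndex (pilotDataOfK T.D T.K)).VQ,
        Set ((logShellsDH (pilotDataOfK T.D T.K) (analyticLogv T.K)).Packet j.1 vQ))
      (frobAdm : ℤ → ℤ → ∀ (j : (thetaIndex (pilotDataOfK T.D T.K)).Label) (vQ : (thetaIndex (pilotDataOfK T.D T.K)).VQ),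
        Set ((logShellsDH (pilotDataOfK T.D T.K) (analyticLogv T.K)).Packet j vQ) → Prop)
      (frobLogvol : ℤ → ℤ → ∀ (j : (thetaIndex (pilotDataOfK T.D T.K)).Label) (vQ : (thetaIndex (pilotDataOfK T.D T.K)).VQ),
        Set ((logShellsDH (pilotDataOfK T.D T.K) (analyticLogv T.K)).Packet j vQ) → ℝ)
      (frobΨ : ℤ → ℤ → ∀ v : (thetaIndex (pilotDataOfK T.D T.K)).V, v ∈ (thetaIndex (pilotDataOfK T.D T.K)).Vbad →
        Set ((logShellsDH (pilotDataOfK T.D T.K) (analyticLogv T.K)).StarPacket v))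
      (frobMmod : ℤ → ℤ → ∀ j : (thetaIndex (pilotDataOfK T.D T.K)).LabelStar, Set ((logShellsDH (pilotDataOfK T.D T.K) (analyticLogv T.K)).GlobalPacket j.1))
      (unitImage : ℤ → ℤ → ℕ → ∀ (j : (thetaIndex (pilotDataOfK T.D T.K)).Label) (vQ : (thetaIndex (pilotDataOfK T.D T.K)).VQ),
        Set ((logShellsDH (pilotDataOfK T.D T.K) (analyticLogv T.K)).Packet j vQ))
      (ballImage : ℤ → ℤ → ∀ (j : (thetaIndex (pilotDataOfK T.D T.K)).Label) (vQ : (thetaIndex (pilotDataOfK T.D T.K)).VQ),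
        Set ((logShellsDH (pilotDataOfK T.D T.K) (analyticLogv T.K)).Packet j vQ))
      (thetaDiv : ℤ → ℤ → LgpDivisor M (thetaIndex (pilotDataOfK T.D T.K)).lstar)
      (n : ℤ) {HT : Type} {LogLink : HT → HT → Type} {IsFull : ∀ {s t : HT}, LogLink s t → Prop}
      (lat : LGPGaussianLogThetaLattice LogLink IsFull)
      {Frd : Type} {IsoF : Frd → Frd → Type} {Ob : Frd → Type} {realify : Frd → Frd} {Strip : Type}
      {IsoS : Strip → Strip → Type} {Mv : ∀ v : (thetaIndex (pilotDataOfK T.D T.K)).V, v ∈ (thetaIndex (pilotDataOfK T.D T.K)).Vbad → Type}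
      [∀ v h, Monoid (Mv v h)]
      (sig : GlobalLGPFrobenioidSignature (thetaIndex (pilotDataOfK T.D T.K)).lstar (thetaIndex (pilotDataOfK T.D T.K)).V
        (· ∈ (thetaIndex (pilotDataOfK T.D T.K)).Vbad) Frd IsoF Ob realify Strip IsoS Mv)
      (split : SplittingMonoids Mv) {ObΔ : Type} {N : ∀ v : (thetaIndex (pilotDataOfK T.D T.K)).V, v ∈ (thetaIndex (pilotDataOfK T.D T.K)).Vbad → Type}
      [∀ v h, Monoid (N v h)] (qData : QPilotData ObΔ N)
      (qK : ∀ v : (thetaIndex (pilotDataOfK T.D T.K)).V, v ∈ (thetaIndex (pilotDataOfK T.D T.K)).Vbad →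
        Set ((logShellsDH (pilotDataOfK T.D T.K) (analyticLogv T.K)).StarPacket v)),
      ¬ Cor312Vol.PilotKummerCompatHull
          (LatticeSituation.ofShells (logShellsDH (pilotDataOfK T.D T.K) (analyticLogv T.K)) M archPk archSub
            (summandPiecesPr (pilotDataOfK T.D T.K) (logvAnalytic_analyticLogv (F := T.K))).Adm
            (summandPiecesPr (pilotDataOfK T.D T.K) (logvAnalytic_analyticLogv (F := T.K))).logvol Ψ act Mmod region frobAdm frobLogvol frobΨ
            frobMmod unitImage ballImage thetaDiv)
          (settingPrVolSharp (pilotDataOfK T.D T.K) (logvAnalytic_analyticLogv (F := T.K)) M archPk archSub Ψ act Mmod region n lat sig split qData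
            (exists_realising_qIdeles_pilotDataOfK T.D).choose (exists_realising_thetaIdeles_pilotDataOfK T.D).choose
            (exists_realising_qIdeles_pilotDataOfK T.D).choose_spec.1 (exists_realising_qIdeles_pilotDataOfK T.D).choose_spec.2.1)
          (fun _ => Cor312.Setting.qRegion
            (settingPrVolSharp (pilotDataOfK T.D T.K) (logvAnalytic_analyticLogv (F := T.K)) M archPk archSub Ψ act Mmod region n lat sig split qData
              (exists_realising_qIdeles_pilotDataOfK T.D).choose (exists_realising_thetaIdeles_pilotDataOfK T.D).choose
              (exists_realising_qIdeles_pilotDataOfK T.D).choose_spec.1 (exists_realising_qIdeles_pilotDataOfK T.D).choose_spec.2.1)) qK :=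
  GenuineK.not_pilotKummerCompatHull_lamSeven_of_threshold (m := 11) (by omega) (by norm_num) (by norm_num) (by norm_num) (by norm_num; omega) T

end Summit.ABC.IUTFork.Conditional

end
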